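import Summits.Ventures.HSemireg.WedgeHankelPairGrading
import Summits.Ventures.HSemireg.WedgeHankelSiegelIdealPlanes

/-!
# Venture HSemireg — KERNELS AND IMAGES OF A HOMOGENEOUS CLASS ARE HOMOGENEOUS, FOR EVERY ADDITIVE GRADING OF THE SUPPORTS — H10's pair grading and the `(x, y)`-bigrading of the kernels of
# th-7's monomial classes `E_p` (they split along gen 11's planes `x_P ∧ y_Q`) are two instances of ONE lemma about a support statistic `φ` with `φ(s ∪ t) = φ s + φ t`

HONEST FRAMING. Part of the Lean index of the computation cell `pub-hsemireg` (seat p10 gen 19, Sunday typer «UNIFORM-IN-n»).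
Finite-dimensional EXTERIOR ALGEBRA over a field ONLY: no variety, no cohomology theory, no sheaf, no Ext group, no semiregularity map;
nothing here says that HC / HC_CM / HC_AV holds; no Literature fact is declared or used.  Custodian versions as in `WedgeHankelSiegelIdeal` (1/3); the dictionary (the plane `x_P ∧ y_Q` =
the Dolbeault block `H^b(⋀^a T)`; `E_p = Θ^p/p!`) is QUOTED, never asserted.

WHAT IS IN THE TREE.  w3's support calculus (`Sp`, `proj`, `mul_mem_Sp`, `proj_add_proj_not`, `proj_eq_self` / `proj_eq_zero`, `Sp_inf_Sp_eq_bot`); gen 13 `Kr`, `V_eq_map`; H10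
`WedgeHankelPairGrading` (923): the special case `φ = ptype`, `f` transversal; gen 11 `WedgeHankelSiegelIdealPlanes`: `plane n a b = span{x_P ∧ y_Q}`, **`w_spike_mem_plane`**
(`E_p = w_m(δ_p) ∈ plane(m − p, p)`), `finrank_plane_inf_siegelIdeal` (the Siegel ideal plane by plane).  THIS FILE (namespace `Summit.Ventures.HSemireg.Wedge.KernelGrading`, new) proves the
general lemma once and reads off the bigrading of the kernels of the MONOMIAL classes:
* §180 for ANY statistic `φ : Finset I → A` into a cancellative commutative monoid with `φ(s ∪ t) = φ s + φ t` on disjoint supports (any generator type `I`): `mul_mem_Sp_fiber` / `_ne`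
  (fibres multiply), **`proj_fiber_mul_eq_zero`** (`θ ∧ η = 0`, `η ∈ Sp(φ = b)` ⇒ `proj_{φ = a} θ ∧ η = 0`), **`proj_fiber_mul`** (`proj_{φ = a+b}(θ ∧ η) = proj_{φ=a} θ ∧ η`),
  `proj_mem_Hom_of_mem`, **`proj_fiber_mem_Kr` / `Kr_eq_sup_inf_Sp_fiber`** (the kernel `Kr(D, η, k)` of a `φ`-HOMOGENEOUS class is the direct sum of its `φ`-homogeneous pieces, every block
  `D`, every field) and **`proj_fiber_mem_V`** (so is the image `V(D, η, k)`).  H10's `proj_ptype_mem_Kr` is the instance `φ = ptype`, `b = 1`.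
* §181 THE `y`-COUNT `ycnt s = #{y-letters in s}` (additive; `xs P ∪ ys Q ↦ |Q|`): `plane_le_Sp_ycnt` (`plane(a, b) ≤ Sp(ycnt = b)`), hence **`proj_ycnt_mem_Kr_w_spike` /
  `proj_ycnt_mem_V_w_spike`: the kernel and the image of th-7's MONOMIAL class `E_p = w_m(δ_p)` in every degree split along the number of `y`-letters** — with the total degree fixed,
  along gen 11's planes `(k − b, b)` (`Kr_w_spike_eq_sup_inf_Sp_ycnt`); the field-free shadow of I4's «`E_p` is a weight vector of the diagonal torus of `GL₂`» (H1b transports kernels),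
  exactly as H10 is the shadow of H9b.  NOT true for a general class `w_n(q)` (it mixes the planes; only the pair grading survives).
NOT typed here: the twisted bigrading of node classes at `λ ≠ 0, ∞` (conjugate by `Φs λ`); plane-by-plane dimension counts of `Kr(univ, E_p, k)` (gen 11/13 have the Siegel-ideal
counts); anything Ext-side.  Class side only; new names only.
-/

open Module

namespace Summit.Ventures.HSemireg.Wedge.KernelGrading

open Summit.Ventures.HSemireg.Wedge Summit.Ventures.HSemireg.Wedge.Kunneth Summit.Ventures.HSemireg.Wedge.Hankel
  Summit.Ventures.HSemireg.Wedge.KunnethKernel Summit.Ventures.HSemireg.Wedge.Weil Summit.Ventures.HSemireg.Wedge.HankelSiegelIdeal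

variable (K : Type*) [Field K]

section General

variable {I : Type*} [LinearOrder I] [Fintype I] {A : Type*} [AddCancelCommMonoid A] [DecidableEq A]

/-! ## §180. Kernels and images of a homogeneous class are homogeneous -/

omit [DecidableEq A] in
/-- **fibres of an additive support statistic multiply: `Sp(φ = a) · Sp(φ = b) ≤ Sp(φ = a + b)`.** -/
theorem mul_mem_Sp_fiber {φ : Finset I → A} (hφ : ∀ s t : Finset I, Disjoint s t → φ (s ∪ t) = φ s + φ t) {a b : A} {θ η : HT K I}
    (hθ : θ ∈ Sp K (fun s => φ s = a)) (hη : η ∈ Sp K (fun s => φ s = b)) : θ * η ∈ Sp K (fun s => φ s = a + b) :=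
  mul_mem_Sp (fun s t hd hs ht => by rw [hφ s t hd, hs, ht]) hθ hη

omit [DecidableEq A] in
/-- … and the complement of a fibre times a fibre misses the sum fibre (cancellation). -/
theorem mul_mem_Sp_fiber_ne {φ : Finset I → A} (hφ : ∀ s t : Finset I, Disjoint s t → φ (s ∪ t) = φ s + φ t) {a b : A} {θ η : HT K I}
    (hθ : θ ∈ Sp K (fun s => ¬ φ s = a)) (hη : η ∈ Sp K (fun s => φ s = b)) : θ * η ∈ Sp K (fun s => ¬ φ s = a + b) :=
  mul_mem_Sp (fun s t hd hs ht h => hs (add_right_cancel (b := b) (by rw [← ht, ← hφ s t hd, h, ht]))) hθ hη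

/-- everything is a sum of monomials (any generator type). -/
lemma mem_Sp_true' (θ : HT K I) : θ ∈ Sp K (fun _ : Finset I => True) := by
  have e : (fun s : Finset I => B K I s) '' {s | True} = Set.range (B K I) := by ext x; simp
  rw [Sp, e, (B K I).span_eq]
  exact Submodule.mem_top

/-- **IF `θ ∧ η = 0` FOR A `φ`-HOMOGENEOUS `η ∈ Sp(φ = b)`, THEN EVERY `φ`-PIECE OF `θ` KILLS `η`: `proj_{φ = a} θ ∧ η = 0`.** -/
theorem proj_fiber_mul_eq_zero {φ : Finset I → A} (hφ : ∀ s t : Finset I, Disjoint s t → φ (s ∪ t) = φ s + φ t) (a : A) {b : A} {θ η : HT K I}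
    (hη : η ∈ Sp K (fun s => φ s = b)) (h : θ * η = 0) : proj (K := K) (fun s => φ s = a) θ * η = 0 := by
  classical
  have hsplit := proj_add_proj_not (K := K) (fun s : Finset I => φ s = a) θ
  have h1 : proj (K := K) (fun s => φ s = a) θ * η ∈ Sp K (fun u => φ u = a + b) := mul_mem_Sp_fiber K hφ (proj_mem _ θ) hη
  have h2 : proj (K := K) (fun s => ¬ φ s = a) θ * η ∈ Sp K (fun u => ¬ φ u = a + b) := mul_mem_Sp_fiber_ne K hφ (proj_mem _ θ) hη
  have hsum : proj (K := K) (fun s => φ s = a) θ * η + proj (K := K) (fun s => ¬ φ s = a) θ * η = 0 := by rw [← add_mul, hsplit, h]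
  have hmem : proj (K := K) (fun s => φ s = a) θ * η ∈ Sp K (fun u => φ u = a + b) ⊓ Sp K (fun u => ¬ φ u = a + b) :=
    ⟨h1, by rw [eq_neg_of_add_eq_zero_left hsum]; exact Submodule.neg_mem _ h2⟩
  rw [Sp_inf_Sp_eq_bot (fun s hs hn => hn hs)] at hmem
  exact (Submodule.mem_bot K).mp hmem

/-- **`proj_{φ = a + b}(θ ∧ η) = proj_{φ = a}(θ) ∧ η`** for `η ∈ Sp(φ = b)`. -/
theorem proj_fiber_mul {φ : Finset I → A} (hφ : ∀ s t : Finset I, Disjoint s t → φ (s ∪ t) = φ s + φ t) (a : A) {b : A} (θ : HT K I) {η : HT K I}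
    (hη : η ∈ Sp K (fun s => φ s = b)) : proj (K := K) (fun s => φ s = a + b) (θ * η) = proj (K := K) (fun s => φ s = a) θ * η := by
  classical
  conv_lhs => rw [← proj_add_proj_not (K := K) (fun s : Finset I => φ s = a) θ]
  rw [add_mul, map_add, proj_eq_self (fun s h => h) (mul_mem_Sp_fiber K hφ (proj_mem _ θ) hη),
    proj_eq_zero (Q := fun s : Finset I => ¬ φ s = a + b) (fun s h => h) (mul_mem_Sp_fiber_ne K hφ (proj_mem _ θ) hη), add_zero]

/-- projections preserve `Hom(D, k)` (it is a support span). -/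
lemma proj_mem_Hom_of_mem (P : Finset I → Prop) [DecidablePred P] {D : Finset I} {k : ℕ} {θ : HT K I} (hθ : θ ∈ Hom K I D k) : proj (K := K) P θ ∈ Hom K I D k := by
  rw [Hom_eq_Sp] at hθ ⊢
  exact Sp_mono (fun s hs => hs.1) (proj_mem_and hθ)

/-- **THE KERNEL OF A HOMOGENEOUS CLASS IS HOMOGENEOUS: `θ ∈ Kr(D, η, k)`, `η ∈ Sp(φ = b)` ⇒ `proj_{φ = a} θ ∈ Kr(D, η, k)`** (every block `D`, every degree, every field). -/
theorem proj_fiber_mem_Kr {φ : Finset I → A} (hφ : ∀ s t : Finset I, Disjoint s t → φ (s ∪ t) = φ s + φ t) (a : A) {b : A} {η : HT K I}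
    (hη : η ∈ Sp K (fun s => φ s = b)) {D : Finset I} {k : ℕ} {θ : HT K I} (hθ : θ ∈ Kr K D η k) : proj (K := K) (fun s => φ s = a) θ ∈ Kr K D η k := by
  classical
  rw [mem_Kr] at hθ ⊢
  exact ⟨proj_mem_Hom_of_mem K _ hθ.1, proj_fiber_mul_eq_zero K hφ a hη hθ.2⟩

/-- the complementary piece stays in the kernel as well. -/
theorem proj_not_fiber_mem_Kr {φ : Finset I → A} (hφ : ∀ s t : Finset I, Disjoint s t → φ (s ∪ t) = φ s + φ t) (a : A) {b : A} {η : HT K I}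
    (hη : η ∈ Sp K (fun s => φ s = b)) {D : Finset I} {k : ℕ} {θ : HT K I} (hθ : θ ∈ Kr K D η k) : proj (K := K) (fun s => ¬ φ s = a) θ ∈ Kr K D η k := by
  classical
  have e : proj (K := K) (fun s : Finset I => ¬ φ s = a) θ = θ - proj (K := K) (fun s : Finset I => φ s = a) θ :=
    eq_sub_of_add_eq' (proj_add_proj_not (K := K) (fun s : Finset I => φ s = a) θ)
  rw [e]
  exact Submodule.sub_mem _ hθ (proj_fiber_mem_Kr K hφ a hη hθ)

/-- **`Kr(D, η, k) = (Kr ⊓ Sp(φ = a)) ⊔ (Kr ⊓ Sp(φ ≠ a))`** for a `φ`-homogeneous `η` (the two pieces meet in `0`). -/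
theorem Kr_eq_sup_inf_Sp_fiber {φ : Finset I → A} (hφ : ∀ s t : Finset I, Disjoint s t → φ (s ∪ t) = φ s + φ t) (a : A) {b : A} {η : HT K I}
    (hη : η ∈ Sp K (fun s => φ s = b)) (D : Finset I) (k : ℕ) :
    Kr K D η k = Kr K D η k ⊓ Sp K (fun s => φ s = a) ⊔ Kr K D η k ⊓ Sp K (fun s => ¬ φ s = a) := by
  classical
  refine le_antisymm (fun θ hθ => ?_) (sup_le inf_le_left inf_le_left)
  rw [← proj_add_proj_not (K := K) (fun s : Finset I => φ s = a) θ]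
  exact Submodule.add_mem_sup ⟨proj_fiber_mem_Kr K hφ a hη hθ, proj_mem _ θ⟩ ⟨proj_not_fiber_mem_Kr K hφ a hη hθ, proj_mem _ θ⟩

omit [DecidableEq A] in
/-- a multiple of a `φ`-homogeneous class lies in the fibres `φ = a + b`. -/
theorem mul_mem_Sp_fiber_exists {φ : Finset I → A} (hφ : ∀ s t : Finset I, Disjoint s t → φ (s ∪ t) = φ s + φ t) {b : A} (θ : HT K I) {η : HT K I}
    (hη : η ∈ Sp K (fun s => φ s = b)) : θ * η ∈ Sp K (fun u => ∃ a, φ u = a + b) :=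
  mul_mem_Sp (P := fun _ => True) (fun s t hd _ ht => ⟨φ s, by rw [hφ s t hd, ht]⟩) (mem_Sp_true' K θ) hη

/-- **THE IMAGE OF A HOMOGENEOUS CLASS IS HOMOGENEOUS: `v ∈ V(D, η, k)`, `η ∈ Sp(φ = b)` ⇒ `proj_{φ = c} v ∈ V(D, η, k)`** for every `c`. -/
theorem proj_fiber_mem_V {φ : Finset I → A} (hφ : ∀ s t : Finset I, Disjoint s t → φ (s ∪ t) = φ s + φ t) (c : A) {b : A} {η : HT K I}
    (hη : η ∈ Sp K (fun s => φ s = b)) {D : Finset I} {k : ℕ} {v : HT K I} (hv : v ∈ V K I D η k) : proj (K := K) (fun s => φ s = c) v ∈ V K I D η k := by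
  classical
  rw [V_eq_map] at hv ⊢
  obtain ⟨θ, hθ, rfl⟩ := hv
  by_cases hc : ∃ a, c = a + b
  · obtain ⟨a, rfl⟩ := hc
    rw [LinearMap.mulRight_apply, proj_fiber_mul K hφ a θ hη]
    exact Submodule.mem_map_of_mem (proj_mem_Hom_of_mem K _ hθ)
  · rw [LinearMap.mulRight_apply, proj_eq_zero (Q := fun u : Finset I => ∃ a, φ u = a + b) (fun s ⟨a, ha⟩ h => hc ⟨a, by rw [← h, ha]⟩) (mul_mem_Sp_fiber_exists K hφ θ hη)]
    exact Submodule.zero_mem _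

end General

/-! ## §181. The `y`-count: kernels and images of th-7's monomial classes are bigraded -/

section YCount

variable {N : ℕ}

/-- the number of `y`-letters of a support is additive on disjoint unions. -/
lemma ycnt_union {s t : Finset (In N)} (h : Disjoint s t) :
    ((s ∪ t).filter fun i : In N => N ≤ (i : ℕ)).card = (s.filter fun i : In N => N ≤ (i : ℕ)).card + (t.filter fun i : In N => N ≤ (i : ℕ)).card := by
  rw [Finset.filter_union, Finset.card_union_of_disjoint (Finset.disjoint_filter_filter h)]

/-- the `y`-letters of `xs P ∪ ys Q` are `ys Q`: the `y`-count of a plane monomial's support is `|Q|`. -/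
lemma ycnt_xs_union_ys (P Q : Finset (Fin N)) : ((xs P ∪ ys Q).filter fun i : In N => N ≤ (i : ℕ)).card = Q.card := by
  have e : ((xs P ∪ ys Q).filter fun i : In N => N ≤ (i : ℕ)) = ys Q := by
    ext i
    simp only [Finset.mem_filter, Finset.mem_union, xs, ys, Finset.mem_map, Fin.castAddEmb_apply, Fin.natAddEmb_apply]
    constructor
    · rintro ⟨h | h, hi⟩
      · obtain ⟨a, _, rfl⟩ := h
        exact absurd hi (by rw [Fin.val_castAdd]; exact Nat.not_le.mpr a.2)
      · exact h
    · rintro ⟨a, ha, rfl⟩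
      exact ⟨Or.inr ⟨a, ha, rfl⟩, by rw [Fin.val_natAdd]; exact Nat.le_add_right N a⟩
  rw [e, ys, Finset.card_map]

/-- **gen 11's plane lies in a `y`-count fibre: `plane(a, b) ≤ Sp(ycnt = b)`.** -/
theorem plane_le_Sp_ycnt (a b : ℕ) : plane K N a b ≤ Sp K (fun s : Finset (In N) => (s.filter fun i : In N => N ≤ (i : ℕ)).card = b) := by
  rw [plane, Submodule.span_le]
  rintro _ ⟨i, rfl⟩
  rw [SetLike.mem_coe, pmon]
  exact B_mem_Sp (by rw [ycnt_xs_union_ys]; exact i.2.2)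

/-- th-7's monomial class `E_p = w_m(δ_p)` has exactly `p` letters `y` in every monomial (`p ≤ m ≤ N`). -/
theorem w_spike_mem_Sp_ycnt {m : ℕ} (hm : m ≤ N) {p : ℕ} (hp : p ≤ m) :
    w K N m (fun j => if j = p then (1 : K) else 0) ∈ Sp K (fun s : Finset (In N) => (s.filter fun i : In N => N ≤ (i : ℕ)).card = p) :=
  plane_le_Sp_ycnt K (m - p) p (w_spike_mem_plane K hm hp)

/-- **THE KERNEL OF A MONOMIAL CLASS IS BIGRADED: `θ ∈ Kr(D, E_p, k) ⇒ proj_{ycnt = b} θ ∈ Kr(D, E_p, k)`** for every `b` (`E_p = w_m(δ_p)`, `p ≤ m ≤ N`; every block `D`, degree `k`,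
field) — with the total degree `k` fixed, the kernel splits along gen 11's planes `(k − b, b)`. -/
theorem proj_ycnt_mem_Kr_w_spike {m : ℕ} (hm : m ≤ N) {p : ℕ} (hp : p ≤ m) (b : ℕ) {D : Finset (In N)} {k : ℕ} {θ : HT K (In N)}
    (hθ : θ ∈ Kr K D (w K N m (fun j => if j = p then (1 : K) else 0)) k) :
    proj (K := K) (fun s : Finset (In N) => (s.filter fun i : In N => N ≤ (i : ℕ)).card = b) θ ∈ Kr K D (w K N m (fun j => if j = p then (1 : K) else 0)) k :=
  proj_fiber_mem_Kr K (fun _ _ h => ycnt_union h) b (w_spike_mem_Sp_ycnt K hm hp) hθ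

/-- the splitting `Kr(D, E_p, k) = (Kr ⊓ Sp(ycnt = b)) ⊔ (Kr ⊓ Sp(ycnt ≠ b))`. -/
theorem Kr_w_spike_eq_sup_inf_Sp_ycnt {m : ℕ} (hm : m ≤ N) {p : ℕ} (hp : p ≤ m) (b : ℕ) (D : Finset (In N)) (k : ℕ) :
    Kr K D (w K N m (fun j => if j = p then (1 : K) else 0)) k =
      Kr K D (w K N m (fun j => if j = p then (1 : K) else 0)) k ⊓ Sp K (fun s : Finset (In N) => (s.filter fun i : In N => N ≤ (i : ℕ)).card = b) ⊔
        Kr K D (w K N m (fun j => if j = p then (1 : K) else 0)) k ⊓ Sp K (fun s : Finset (In N) => ¬ (s.filter fun i : In N => N ≤ (i : ℕ)).card = b) :=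
  Kr_eq_sup_inf_Sp_fiber K (fun _ _ h => ycnt_union h) b (w_spike_mem_Sp_ycnt K hm hp) D k

/-- **THE IMAGE OF A MONOMIAL CLASS IS BIGRADED: `v ∈ V(D, E_p, k) ⇒ proj_{ycnt = c} v ∈ V(D, E_p, k)`** for every `c`. -/
theorem proj_ycnt_mem_V_w_spike {m : ℕ} (hm : m ≤ N) {p : ℕ} (hp : p ≤ m) (c : ℕ) {D : Finset (In N)} {k : ℕ} {v : HT K (In N)}
    (hv : v ∈ V K (In N) D (w K N m (fun j => if j = p then (1 : K) else 0)) k) :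
    proj (K := K) (fun s : Finset (In N) => (s.filter fun i : In N => N ≤ (i : ℕ)).card = c) v ∈ V K (In N) D (w K N m (fun j => if j = p then (1 : K) else 0)) k :=
  proj_fiber_mem_V K (fun _ _ h => ycnt_union h) c (w_spike_mem_Sp_ycnt K hm hp) hv

/-- H10 RECOVERED as an instance: for a TRANSVERSAL class `f` (`ptype ≡ 1` on its supports) and the additive statistic `ptype`, `proj_{ptype = τ} θ ∈ Kr(D, f, k)` — here for every
block `D` (H10 had `D = univ`). -/
theorem proj_ptype_mem_Kr_of_Tr (τ : Fin N → ℕ) {f : HT K (In N)} (hf : f ∈ Sp K (Tr (N := N))) {D : Finset (In N)} {k : ℕ} {θ : HT K (In N)} (hθ : θ ∈ Kr K D f k) :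
    proj (K := K) (fun s : Finset (In N) => HankelPairGrading.ptype s = τ) θ ∈ Kr K D f k :=
  proj_fiber_mem_Kr K (fun _ _ h => HankelPairGrading.ptype_union h) τ (b := fun _ => 1)
    (Sp_mono (fun _ hs => HankelPairGrading.ptype_of_Tr hs) hf) hθ

end YCount

end Summit.Ventures.HSemireg.Wedge.KernelGrading
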